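import Summits.AtomisticToContinuum.Crystallization.Theorems.ChargedEnergyGapCoherencePricing

/-!
# `PricedLinkCensus.ChargedEnergyGap` (stmt-AtomisticToContinuum-14231) — the BALL WEIGHTS: a canonical smooth partition of unity on the cores
# (decomp-a2c lens 3, generation 47, part I-A; over part H-B `ChargedEnergyGapCoherencePricing`; critic rows 894 / 901 (d)(i))

The engine target of record (row 901 (a)) is NGP `IncoherentGrossDebitPricing (3/20) (1/10) (6/5) 10 (1/100) 40 (1/10) 40`: a GLOBAL
statement — every periodic configuration pays `κ` per incoherent core, up to a debit `C` per other gross charged motif site.  Every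
engine that could prove it (rigidity + incompatibility + core energetics) works LOCALLY, defect by defect.  Parts I-A / I-B are the
certified translation between the two: an EXACT LEDGER (part I-B) writing the excess of `Q` as a sum of smooth BALL accounts, one per
incoherent core, plus one FAR account, over weights (this file) that form a partition of unity built canonically from the cores
themselves — no net, no packing lemma, no multiplicity constant.

§1 The species as predicates: `IsCore` (= the incoherent interfacial deep-rigid compact gross charged core of parts F–H, by `rfl`) and
   `IsOtherGross` (gross charged, not a core); ★ `motifChargedGross = motifCoreIncoherent + #other` (the debit of NGP is the other count).
§2 THE WEIGHTS at scale `ϱ`.  `smoothStep` = the C³ step `t⁴(35 − 84t + 70t² − 20t³)` clamped to `[0, 1]`; the BUMP of a core `x`,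
   `bump ϱ Q x q = smoothStep (2 − 2·dist(q, orbit of x)/ϱ)` — `1` within `ϱ/2` of the lattice orbit of `x`, `0` beyond `ϱ`, radial and
   C³ in between, `Λ`-periodic by construction (`Metric.infDist` to the orbit); the COVER `S = Σ_{cores} bump` (`coverSum`); the FAR WEIGHT
   `w = ((1 − S)₊)⁴` (`farWeight`: `= 1` where no core is within `ϱ`, `= 0` within `ϱ/2` of any core, C³); the BALL WEIGHTS
   `ψ_x = bump_x · (1 − w)/S` (`ballWeight`).  ★ `Σ_x ψ_x + w = 1` EVERYWHERE, every parameter (`ballWeight_sum_add_farWeight`, pure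
   algebra: `S·(1 − w)/S + w`; at `S = 0`, `w = 1`); all weights in `[0, 1]`; `w = 0` and `Σ_x ψ_x = 1` at every core site.
   WHY SMOOTH (MEMO §3, finding F1): a SHARP ball leaks at FIRST order — the per-site first-order excess `½ Σ_v V'(|v|) v̂·δ_v` has no
   sign, and a radial shell displacement of amplitude `5·10⁻³` just outside a sharp `80`-ball drives that ball's account to `≈ −55` around
   a genuine core (shell energy `+20`, boundary leak `−75`); with C³ radial weights of transition width `ϱ/2` the leak about an
   UNSTRESSED crystal is a vanishing fraction `≲ |V'|/(k A ϱ)` of the captured elastic energy, and where it dominates (`A < |V'|/(k ϱ²)`)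
   it is `≲ 4·10⁻⁵` in absolute terms; about a STRESSED zone (the `1/r` field of a dislocation crossing the transition shell) Cauchy–Born
   pointwise (`W_CB(F) ≥ e*`) closes the would-be first-order account transfer (MEMO §3 F6), leaving strain-gradient remainders `≈ 10⁻²`
   per core — whence the shared slack dial `c₁` of part I-B's pieces (BALL pays `> c₁` per core, FAR may lose `c₁` per core).
All `[this work]`.
-/

noncomputable section

open scoped Classical
open Literature.MathematicalPhysics.StatisticalMechanics
open Literature.Geometry.DiscreteGeometry
open Summit.AtomisticToContinuum.Crystallization.Theses.PricedLinkCensus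
open Summit.AtomisticToContinuum.Crystallization.Theorems.ChargedEnergyGapNegative

namespace Summit.AtomisticToContinuum.Crystallization.Theorems.ChargedEnergyGapChartDial

/-! ## §1 The species as predicates -/

section Species

variable (θ ε R r η L δ L' : ℝ)

/-- **INCOHERENT CORE** (the engine target's species, parts F–H) as a predicate on motif sites: charged, not `θ`-charted (gross), not
exposed, not improvable, not deep-improvable (deep-rigid), crystal within `L` (interfacial), NOT coherent at `(δ, L')` (holonomy). -/
def IsCore (Q : PeriodicConfiguration 3) (x : Q.motif) : Prop :=
  (((((Charged Q x ∧ ¬ ChartedAt θ Q (pt Q x)) ∧ ¬ Exposed ε R Q x) ∧ ¬ Improvable r η Q x) ∧ ¬ DeepImprovable r η Q x) ∧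
      CrystalWithin L Q (x : E3)) ∧ ¬ CoherentWithin δ L' Q (x : E3)

/-- **OTHER GROSS CHARGED** motif site: gross charged and not an incoherent core (exposed, improvable, shallow-rigid, frustrated or
coherent — the five debited species of NGP). -/
def IsOtherGross (Q : PeriodicConfiguration 3) (x : Q.motif) : Prop :=
  (Charged Q x ∧ ¬ ChartedAt θ Q (pt Q x)) ∧ ¬ IsCore θ ε R r η L δ L' Q x

variable {θ ε R r η L δ L'}

/-- An incoherent core is a gross (uncharted) charged site. -/
theorem IsCore.gross {Q : PeriodicConfiguration 3} {x : Q.motif} (h : IsCore θ ε R r η L δ L' Q x) :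
    Charged Q x ∧ ¬ ChartedAt θ Q (pt Q x) :=
  h.1.1.1.1.1

/-- An incoherent core is not coherent at `(δ, L')`. -/
theorem IsCore.not_coherentWithin {Q : PeriodicConfiguration 3} {x : Q.motif} (h : IsCore θ ε R r η L δ L' Q x) :
    ¬ CoherentWithin δ L' Q (x : E3) :=
  h.2

/-- An other-gross site is not an incoherent core. -/
theorem IsOtherGross.not_isCore {Q : PeriodicConfiguration 3} {x : Q.motif} (h : IsOtherGross θ ε R r η L δ L' Q x) :
    ¬ IsCore θ ε R r η L δ L' Q x :=
  h.2

variable (θ ε R r η L δ L')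

/-- The incoherent count of part H-A is the number of cores (definitional). -/
theorem motifCoreIncoherent_eq_card_isCore (Q : PeriodicConfiguration 3) :
    motifCoreIncoherent θ ε R r η L δ L' Q = Nat.card {x : Q.motif // IsCore θ ε R r η L δ L' Q x} :=
  rfl

/-- ★ gross charged = cores + other (so the debit count of NGP, `motifChargedGross − motifCoreIncoherent`, is `#other`). -/
theorem motifChargedGross_eq_core_add_other (Q : PeriodicConfiguration 3) :
    motifChargedGross θ Q = motifCoreIncoherent θ ε R r η L δ L' Q + Nat.card {x : Q.motif // IsOtherGross θ ε R r η L δ L' Q x} := by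
  rw [motifChargedGross, natCard_subtype_split (fun x : Q.motif => Charged Q x ∧ ¬ ChartedAt θ Q (pt Q x))
    (fun x => IsCore θ ε R r η L δ L' Q x), add_comm]
  congr 1
  exact Nat.card_congr (Equiv.subtypeEquivRight fun x => ⟨fun h => h.2, fun h => ⟨IsCore.gross h, h⟩⟩)

/-- The debit count of NGP as a real number. -/
theorem cast_motifChargedGross_sub_incoherent (Q : PeriodicConfiguration 3) :
    (motifChargedGross θ Q : ℝ) - (motifCoreIncoherent θ ε R r η L δ L' Q : ℝ) =
      (Nat.card {x : Q.motif // IsOtherGross θ ε R r η L δ L' Q x} : ℝ) := by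
  rw [motifChargedGross_eq_core_add_other θ ε R r η L δ L' Q, Nat.cast_add]; ring

/-- Indicator sums over the motif are the species counts. -/
theorem sum_ite_isCore_eq (Q : PeriodicConfiguration 3) :
    (∑ y : Q.motif, if IsCore θ ε R r η L δ L' Q y then (1 : ℝ) else 0) = (motifCoreIncoherent θ ε R r η L δ L' Q : ℝ) := by
  rw [Finset.sum_boole, motifCoreIncoherent_eq_card_isCore, Nat.card_eq_fintype_card, Fintype.card_subtype]

/-- The indicator sum of the other-gross species over the motif is its count. -/
theorem sum_ite_isOtherGross_eq (Q : PeriodicConfiguration 3) :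
    (∑ y : Q.motif, if IsOtherGross θ ε R r η L δ L' Q y then (1 : ℝ) else 0) =
      (Nat.card {x : Q.motif // IsOtherGross θ ε R r η L δ L' Q x} : ℝ) := by
  rw [Finset.sum_boole, Nat.card_eq_fintype_card, Fintype.card_subtype]

end Species

/-! ## §2 The weights: smooth step, bumps, cover, far weight, ball weights -/

/-- The C³ **smooth step**: `0` for `t ≤ 0`, `1` for `t ≥ 1`, `t⁴(35 − 84t + 70t² − 20t³)` in between (value and three derivatives
match at both ends). -/
def smoothStep (t : ℝ) : ℝ :=
  (max 0 (min 1 t)) ^ 4 * (35 - 84 * max 0 (min 1 t) + 70 * max 0 (min 1 t) ^ 2 - 20 * max 0 (min 1 t) ^ 3)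

/-- The smooth step vanishes on `t ≤ 0`. -/
theorem smoothStep_of_le_zero {t : ℝ} (ht : t ≤ 0) : smoothStep t = 0 := by
  have h : max 0 (min 1 t) = 0 := max_eq_left ((min_le_right _ _).trans ht)
  simp [smoothStep, h]

/-- The smooth step equals `1` on `1 ≤ t`. -/
theorem smoothStep_of_one_le {t : ℝ} (ht : 1 ≤ t) : smoothStep t = 1 := by
  have h : max 0 (min 1 t) = 1 := by rw [min_eq_left ht, max_eq_right zero_le_one]
  simp [smoothStep, h]; norm_num

/-- `1 − smoothStep t = (1 − s)⁴ (1 + 4s + 10s² + 20s³)` with `s` the clamped argument: both bounds follow. -/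
theorem smoothStep_nonneg (t : ℝ) : 0 ≤ smoothStep t := by
  have h0 : 0 ≤ max 0 (min 1 t) := le_max_left _ _
  have h1 : max 0 (min 1 t) ≤ 1 := max_le zero_le_one (min_le_left _ _)
  have hc : 0 ≤ 35 - 84 * max 0 (min 1 t) + 70 * max 0 (min 1 t) ^ 2 - 20 * max 0 (min 1 t) ^ 3 := by
    nlinarith [mul_nonneg h0 h0, mul_nonneg (mul_nonneg h0 h0) h0, mul_nonneg (sub_nonneg.2 h1) (mul_nonneg h0 h0),
      mul_nonneg (sub_nonneg.2 h1) h0, sub_nonneg.2 h1]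
  exact mul_nonneg (pow_nonneg h0 4) hc

/-- The smooth step is at most `1`. -/
theorem smoothStep_le_one (t : ℝ) : smoothStep t ≤ 1 := by
  have h0 : 0 ≤ max 0 (min 1 t) := le_max_left _ _
  have h1 : max 0 (min 1 t) ≤ 1 := max_le zero_le_one (min_le_left _ _)
  have key : 1 - smoothStep t =
      (1 - max 0 (min 1 t)) ^ 4 * (1 + 4 * max 0 (min 1 t) + 10 * max 0 (min 1 t) ^ 2 + 20 * max 0 (min 1 t) ^ 3) := by
    simp only [smoothStep]; ring
  have : 0 ≤ 1 - smoothStep t := by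
    rw [key]; exact mul_nonneg (pow_nonneg (sub_nonneg.2 h1) 4) (by positivity)
  linarith

/-- Distance from a point of space to the lattice ORBIT of a motif site (`Λ`-periodic in the point). -/
def orbitDist (Q : PeriodicConfiguration 3) (x : Q.motif) (q : E3) : ℝ :=
  Metric.infDist q {z : E3 | ∃ g ∈ Q.lattice, z = (x : E3) + g}

/-- The distance to an orbit is non-negative. -/
theorem orbitDist_nonneg (Q : PeriodicConfiguration 3) (x : Q.motif) (q : E3) : 0 ≤ orbitDist Q x q :=
  Metric.infDist_nonneg

/-- A motif site is on its own orbit. -/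
theorem orbitDist_self (Q : PeriodicConfiguration 3) (x : Q.motif) : orbitDist Q x (x : E3) = 0 :=
  Metric.infDist_zero_of_mem ⟨0, Q.lattice.zero_mem, (add_zero _).symm⟩

/-- The **BUMP** of core `x` at scale `ϱ`: `smoothStep (2 − 2·orbitDist/ϱ)` — `1` within `ϱ/2` of the orbit, `0` beyond `ϱ`. -/
def bump (ϱ : ℝ) (Q : PeriodicConfiguration 3) (x : Q.motif) (q : E3) : ℝ :=
  smoothStep (2 - 2 * orbitDist Q x q / ϱ)

/-- Bumps are non-negative. -/
theorem bump_nonneg (ϱ : ℝ) (Q : PeriodicConfiguration 3) (x : Q.motif) (q : E3) : 0 ≤ bump ϱ Q x q :=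
  smoothStep_nonneg _

/-- Bumps are at most `1`. -/
theorem bump_le_one (ϱ : ℝ) (Q : PeriodicConfiguration 3) (x : Q.motif) (q : E3) : bump ϱ Q x q ≤ 1 :=
  smoothStep_le_one _

/-- Inner plateau: within `ϱ/2` of the orbit the bump is `1`. -/
theorem bump_eq_one_of_le {ϱ : ℝ} (hϱ : 0 < ϱ) {Q : PeriodicConfiguration 3} {x : Q.motif} {q : E3}
    (h : orbitDist Q x q ≤ ϱ / 2) : bump ϱ Q x q = 1 := by
  refine smoothStep_of_one_le ?_
  have : 2 * orbitDist Q x q / ϱ ≤ 1 := by rw [div_le_iff₀ hϱ]; linarith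
  linarith

/-- Outer support: beyond `ϱ` from the orbit the bump is `0`. -/
theorem bump_eq_zero_of_le {ϱ : ℝ} (hϱ : 0 < ϱ) {Q : PeriodicConfiguration 3} {x : Q.motif} {q : E3}
    (h : ϱ ≤ orbitDist Q x q) : bump ϱ Q x q = 0 := by
  refine smoothStep_of_le_zero ?_
  have : 2 ≤ 2 * orbitDist Q x q / ϱ := by rw [le_div_iff₀ hϱ]; linarith
  linarith

/-- The bump of a core at its own site is `1` (any scale: `smoothStep 2 = 1`). -/
theorem bump_self (ϱ : ℝ) (Q : PeriodicConfiguration 3) (x : Q.motif) : bump ϱ Q x (x : E3) = 1 := by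
  rw [bump, orbitDist_self, mul_zero, zero_div, sub_zero]
  exact smoothStep_of_one_le (by norm_num)

section Weights

variable (θ ε R r η L δ L' ϱ : ℝ)

/-- The core bump as an indicator-weighted function (zero for non-cores). -/
def coreBump (Q : PeriodicConfiguration 3) (x : Q.motif) (q : E3) : ℝ :=
  if IsCore θ ε R r η L δ L' Q x then bump ϱ Q x q else 0

/-- The **COVER**: sum of the bumps of all incoherent cores of the motif (a `Λ`-periodic C³ function of `q`). -/
def coverSum (Q : PeriodicConfiguration 3) (q : E3) : ℝ :=
  ∑ x : Q.motif, coreBump θ ε R r η L δ L' ϱ Q x q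

/-- The **FAR WEIGHT** `w = ((1 − S)₊)⁴`: `1` where no core is within `ϱ`, `0` within `ϱ/2` of any core, C³ (`S` is, and `s ↦ (s₊)⁴` is). -/
def farWeight (Q : PeriodicConfiguration 3) (q : E3) : ℝ :=
  (max 0 (1 - coverSum θ ε R r η L δ L' ϱ Q q)) ^ 4

/-- The **BALL WEIGHT** of core `x`: `ψ_x = bump_x · (1 − w)/S` (its share of the covered mass `1 − w`). -/
def ballWeight (Q : PeriodicConfiguration 3) (x : Q.motif) (q : E3) : ℝ :=
  coreBump θ ε R r η L δ L' ϱ Q x q * (1 - farWeight θ ε R r η L δ L' ϱ Q q) / coverSum θ ε R r η L δ L' ϱ Q q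

variable {θ ε R r η L δ L' ϱ}

/-- Core bumps are non-negative. -/
theorem coreBump_nonneg (Q : PeriodicConfiguration 3) (x : Q.motif) (q : E3) : 0 ≤ coreBump θ ε R r η L δ L' ϱ Q x q := by
  unfold coreBump; split_ifs
  · exact bump_nonneg _ _ _ _
  · exact le_rfl

/-- A site that is not an incoherent core carries the zero bump. -/
theorem coreBump_of_not_isCore {Q : PeriodicConfiguration 3} {x : Q.motif} (hx : ¬ IsCore θ ε R r η L δ L' Q x) (q : E3) :
    coreBump θ ε R r η L δ L' ϱ Q x q = 0 := by
  simp [coreBump, hx]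

/-- The cover sum is non-negative. -/
theorem coverSum_nonneg (Q : PeriodicConfiguration 3) (q : E3) : 0 ≤ coverSum θ ε R r η L δ L' ϱ Q q :=
  Finset.sum_nonneg fun x _ => coreBump_nonneg Q x q

/-- At (the site of) a core the cover is at least its own bump, `1`. -/
theorem one_le_coverSum_of_isCore {Q : PeriodicConfiguration 3} {x : Q.motif} (hx : IsCore θ ε R r η L δ L' Q x) :
    1 ≤ coverSum θ ε R r η L δ L' ϱ Q (x : E3) := by
  have h1 : coreBump θ ε R r η L δ L' ϱ Q x (x : E3) = 1 := by simp [coreBump, hx, bump_self]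
  calc (1 : ℝ) = coreBump θ ε R r η L δ L' ϱ Q x (x : E3) := h1.symm
    _ ≤ coverSum θ ε R r η L δ L' ϱ Q (x : E3) :=
        Finset.single_le_sum (f := fun x' : Q.motif => coreBump θ ε R r η L δ L' ϱ Q x' (x : E3))
          (fun x' _ => coreBump_nonneg Q x' _) (Finset.mem_univ x)

/-- The far weight is non-negative. -/
theorem farWeight_nonneg (Q : PeriodicConfiguration 3) (q : E3) : 0 ≤ farWeight θ ε R r η L δ L' ϱ Q q :=
  pow_nonneg (le_max_left _ _) 4

/-- The far weight is at most `1`. -/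
theorem farWeight_le_one (Q : PeriodicConfiguration 3) (q : E3) : farWeight θ ε R r η L δ L' ϱ Q q ≤ 1 := by
  have hS : 0 ≤ coverSum θ ε R r η L δ L' ϱ Q q := coverSum_nonneg Q q
  have h0 : 0 ≤ max 0 (1 - coverSum θ ε R r η L δ L' ϱ Q q) := le_max_left _ _
  have h1 : max 0 (1 - coverSum θ ε R r η L δ L' ϱ Q q) ≤ 1 := max_le zero_le_one (by linarith)
  calc farWeight θ ε R r η L δ L' ϱ Q q = (max 0 (1 - coverSum θ ε R r η L δ L' ϱ Q q)) ^ 4 := rfl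
    _ ≤ 1 ^ 4 := pow_le_pow_left₀ h0 h1 4
    _ = 1 := one_pow 4

/-- Far weight `1` where the cover vanishes (no core within `ϱ`) … -/
theorem farWeight_eq_one_of_coverSum_eq_zero {Q : PeriodicConfiguration 3} {q : E3} (h : coverSum θ ε R r η L δ L' ϱ Q q = 0) :
    farWeight θ ε R r η L δ L' ϱ Q q = 1 := by
  simp [farWeight, h]

/-- … and `0` where the cover is at least `1` (within `ϱ/2` of some core; in particular at every core site). -/
theorem farWeight_eq_zero_of_one_le_coverSum {Q : PeriodicConfiguration 3} {q : E3} (h : 1 ≤ coverSum θ ε R r η L δ L' ϱ Q q) :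
    farWeight θ ε R r η L δ L' ϱ Q q = 0 := by
  have : max 0 (1 - coverSum θ ε R r η L δ L' ϱ Q q) = 0 := max_eq_left (by linarith)
  simp [farWeight, this]

/-- The far weight vanishes at an incoherent core (its own bump is `1` there). -/
theorem farWeight_eq_zero_of_isCore {Q : PeriodicConfiguration 3} {x : Q.motif} (hx : IsCore θ ε R r η L δ L' Q x) :
    farWeight θ ε R r η L δ L' ϱ Q (x : E3) = 0 :=
  farWeight_eq_zero_of_one_le_coverSum (one_le_coverSum_of_isCore hx)

/-- Ball weights are non-negative. -/
theorem ballWeight_nonneg (Q : PeriodicConfiguration 3) (x : Q.motif) (q : E3) : 0 ≤ ballWeight θ ε R r η L δ L' ϱ Q x q :=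
  div_nonneg (mul_nonneg (coreBump_nonneg Q x q) (sub_nonneg.2 (farWeight_le_one Q q))) (coverSum_nonneg Q q)

/-- A site that is not an incoherent core has the zero ball weight. -/
theorem ballWeight_of_not_isCore {Q : PeriodicConfiguration 3} {x : Q.motif} (hx : ¬ IsCore θ ε R r η L δ L' Q x) (q : E3) :
    ballWeight θ ε R r η L δ L' ϱ Q x q = 0 := by
  simp [ballWeight, coreBump_of_not_isCore hx]

/-- ★ **PARTITION OF UNITY** (exact, everywhere, every parameter): `Σ_x ψ_x + w = 1`. -/
theorem ballWeight_sum_add_farWeight (Q : PeriodicConfiguration 3) (q : E3) :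
    (∑ x : Q.motif, ballWeight θ ε R r η L δ L' ϱ Q x q) + farWeight θ ε R r η L δ L' ϱ Q q = 1 := by
  by_cases hS : coverSum θ ε R r η L δ L' ϱ Q q = 0
  · have hball : ∀ x : Q.motif, ballWeight θ ε R r η L δ L' ϱ Q x q = 0 := fun x => by simp [ballWeight, hS]
    simp [hball, farWeight_eq_one_of_coverSum_eq_zero hS]
  · have hsum : (∑ x : Q.motif, ballWeight θ ε R r η L δ L' ϱ Q x q) =
        (∑ x : Q.motif, coreBump θ ε R r η L δ L' ϱ Q x q) * (1 - farWeight θ ε R r η L δ L' ϱ Q q) /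
          coverSum θ ε R r η L δ L' ϱ Q q := by
      rw [Finset.sum_mul, Finset.sum_div]; rfl
    rw [hsum, show (∑ x : Q.motif, coreBump θ ε R r η L δ L' ϱ Q x q) = coverSum θ ε R r η L δ L' ϱ Q q from rfl]
    field_simp
    ring

/-- The ball weights sum to `1 −` the far weight (partition of unity). -/
theorem ballWeight_sum_eq (Q : PeriodicConfiguration 3) (q : E3) :
    (∑ x : Q.motif, ballWeight θ ε R r η L δ L' ϱ Q x q) = 1 - farWeight θ ε R r η L δ L' ϱ Q q := by
  linarith [ballWeight_sum_add_farWeight (θ := θ) (ε := ε) (R := R) (r := r) (η := η) (L := L) (δ := δ) (L' := L') (ϱ := ϱ) Q q]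

/-- Each ball weight is at most `1`. -/
theorem ballWeight_le_one (Q : PeriodicConfiguration 3) (x : Q.motif) (q : E3) : ballWeight θ ε R r η L δ L' ϱ Q x q ≤ 1 := by
  calc ballWeight θ ε R r η L δ L' ϱ Q x q ≤ ∑ x' : Q.motif, ballWeight θ ε R r η L δ L' ϱ Q x' q :=
        Finset.single_le_sum (f := fun x' : Q.motif => ballWeight θ ε R r η L δ L' ϱ Q x' q) (fun x' _ => ballWeight_nonneg Q x' q)
          (Finset.mem_univ x)
    _ = 1 - farWeight θ ε R r η L δ L' ϱ Q q := ballWeight_sum_eq Q q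
    _ ≤ 1 := by linarith [farWeight_nonneg (θ := θ) (ε := ε) (R := R) (r := r) (η := η) (L := L) (δ := δ) (L' := L') (ϱ := ϱ) Q q]

/-- At a core site the ball weights alone sum to `1`. -/
theorem ballWeight_sum_of_isCore {Q : PeriodicConfiguration 3} {y : Q.motif} (hy : IsCore θ ε R r η L δ L' Q y) :
    (∑ x : Q.motif, ballWeight θ ε R r η L δ L' ϱ Q x (y : E3)) = 1 := by
  rw [ballWeight_sum_eq, farWeight_eq_zero_of_isCore hy, sub_zero]

end Weights

end Summit.AtomisticToContinuum.Crystallization.Theorems.ChargedEnergyGapChartDial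

end
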